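import Summits.HodgeConjecture.HodgeConjecture.Theorems.CyclicUnitaryPowersEigenDualBasis

/-!
# The Casimir tensor of a nondegenerate form and the eigen-Casimirs `Σ_a e_{i,a} ⊗ e^{i,a}` in any basis

Helper for stub L `stub_deckUnitaryInvariantsMatching` of the crux `PowersHodgeOfDeckCommutators`
(stmt-HodgeConjecture-19545, route `CyclicUnitaryPowers`, line `unitary-kunneth-fft` v6, lane 2).  For a nondegenerate
bilinear form `B` on a finite-dimensional `W`:

* §1 the CASIMIR tensor `casimir B β = Σ (G_β⁻¹)_{a a'} β a ⊗ β a'` (`G_β` the Gram matrix): it is characterised by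
  `(B(x, ·) ⊗ id) (casimir) = x` (`lcontr_casimir`), hence independent of the basis (`casimir_eq_casimir`);
* §2 coordinate matrices `tmat β X` of `2`-tensors: `tmat β (casimir B β) = G_β⁻¹`, `tmat β ((A ⊗ id) X) = [A]_β · tmat β X`,
  `tmat β (Σ_m y_m ⊗ y'_m) (α, α') = Σ_m β.repr y_m α · β.repr y'_m α'`;
* §3 in the eigen-adapted basis `f` of `CyclicUnitaryPowersEigenDualBasis` the Casimir is
  `B(x₀,x₀)⁻¹ x₀ ⊗ x₀ + Σ_i Σ_a (e_{i,a} ⊗ e^{i,a} + e^{i,a} ⊗ e_{i,a})`, so `(P_{i+1} ⊗ id) casimir = Σ_a e_{i,a} ⊗ e^{i,a}`;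
* §4 **the eigen-Casimir identity in ANY basis `β` of `W`**:
  `Σ_a β.repr (e_{i,a}) α · β.repr (e^{i,a}) α' = ([P_{i+1}]_β · G_β⁻¹) α α'` (`sum_repr_vec_mul_repr_cov`) — the bridge
  from the pair contractions of the GL first fundamental theorem to the cyclic matching tensors `(s^k ⊗ 1)(Casimir)`.

Pure linear algebra; no Hodge theory.
-/

noncomputable section

open Module Matrix
open scoped TensorProduct BigOperators

namespace Summit.HodgeConjecture.HodgeConjecture.Theorems.CyclicUnitaryPowersCasimirMatrix

open Summit.HodgeConjecture.HodgeConjecture.Theorems.CyclicUnitaryPowersSpectralProjectors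
open Summit.HodgeConjecture.HodgeConjecture.Theorems.CyclicUnitaryPowersEigenPairing
open Summit.HodgeConjecture.HodgeConjecture.Theorems.CyclicUnitaryPowersEigenDualBasis

variable {K : Type*} [Field K] {W : Type*} [AddCommGroup W] [Module K W]

/-! ### §1 The Casimir tensor -/

section Casimir

variable {S : Type*} [Fintype S] [DecidableEq S] (B : LinearMap.BilinForm K W)

/-- The Casimir tensor `Σ (G⁻¹)_{a a'} β a ⊗ β a'` of `B` in the basis `β` (`G` the Gram matrix of `β`). [folklore] -/
def casimir (β : Basis S K W) : W ⊗[K] W :=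
  ∑ a, ∑ a', (LinearMap.BilinForm.toMatrix β B)⁻¹ a a' • β a ⊗ₜ[K] β a'

/-- Left contraction with `B(x, ·)`: `y ⊗ y' ↦ B x y • y'`. [folklore] -/
def lcontr (x : W) : W ⊗[K] W →ₗ[K] W := TensorProduct.lift ((LinearMap.lsmul K W).comp (B x))

/-- `lcontr` on pure tensors. [folklore] -/
@[simp] theorem lcontr_tmul (x y y' : W) : lcontr B x (y ⊗ₜ[K] y') = B x y • y' := by
  simp [lcontr]

/-- `lcontr` is linear in the contracting vector. [folklore] -/
theorem lcontr_add (x x' : W) (X : W ⊗[K] W) : lcontr B (x + x') X = lcontr B x X + lcontr B x' X := by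
  induction X using TensorProduct.induction_on with
  | zero => simp
  | tmul y y' => simp [add_smul]
  | add X Y hX hY => rw [map_add, map_add, map_add, hX, hY]; abel

/-- `lcontr` is homogeneous in the contracting vector. [folklore] -/
theorem lcontr_smul (c : K) (x : W) (X : W ⊗[K] W) : lcontr B (c • x) X = c • lcontr B x X := by
  induction X using TensorProduct.induction_on with
  | zero => simp
  | tmul y y' => simp [mul_smul]
  | add X Y hX hY => rw [map_add, map_add, hX, hY, smul_add]

/-- Left contraction as a linear map of the contracting vector. [folklore] -/
def lcontrVec (X : W ⊗[K] W) : W →ₗ[K] W where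
  toFun x := lcontr B x X
  map_add' x x' := lcontr_add B x x' X
  map_smul' c x := lcontr_smul B c x X

/-- Unfolding lemma. [folklore] -/
@[simp] theorem lcontrVec_apply (X : W ⊗[K] W) (x : W) : lcontrVec B X x = lcontr B x X := rfl

/-- **The defining property of the Casimir**: `(B(x,·) ⊗ id) casimir = x`. [folklore] -/
theorem lcontr_casimir (hBn : B.Nondegenerate) (β : Basis S K W) (x : W) : lcontr B x (casimir B β) = x := by
  have hG : (LinearMap.BilinForm.toMatrix β B).det ≠ 0 :=
    Matrix.nondegenerate_iff_det_ne_zero.mp (hBn.toMatrix β)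
  -- reduce to basis vectors `x = β c`
  suffices h : ∀ c, lcontr B (β c) (casimir B β) = β c by
    have hlin : lcontrVec B (casimir B β) = LinearMap.id := β.ext fun c => by rw [lcontrVec_apply, h, LinearMap.id_apply]
    have := LinearMap.congr_fun hlin x
    rwa [lcontrVec_apply, LinearMap.id_apply] at this
  intro c
  unfold casimir
  simp only [map_sum, map_smul, lcontr_tmul, smul_smul]
  rw [Finset.sum_comm]
  have hrow : ∀ a', ∑ a, (LinearMap.BilinForm.toMatrix β B)⁻¹ a a' * B (β c) (β a) =
      ((LinearMap.BilinForm.toMatrix β B) * (LinearMap.BilinForm.toMatrix β B)⁻¹) c a' := by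
    intro a'
    rw [Matrix.mul_apply]
    exact Finset.sum_congr rfl fun a _ => by rw [LinearMap.BilinForm.toMatrix_apply, mul_comm]
  simp_rw [← Finset.sum_smul, hrow, Matrix.mul_nonsing_inv _ (isUnit_iff_ne_zero.mpr hG), Matrix.one_apply, ite_smul,
    one_smul, zero_smul]
  rw [Finset.sum_ite_eq Finset.univ c, if_pos (Finset.mem_univ _)]

omit [DecidableEq S] in
/-- A `2`-tensor all of whose left contractions vanish is zero (`B` nondegenerate). [folklore] -/
theorem eq_zero_of_forall_lcontr (hBn : B.Nondegenerate) (β : Basis S K W) {X : W ⊗[K] W}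
    (h : ∀ x, lcontr B x X = 0) : X = 0 := by
  -- expand `X = Σ_{a'} y_{a'} ⊗ β a'`
  let y : S → W := fun a' => ∑ a, (β.tensorProduct β).repr X (a, a') • β a
  have hX : X = ∑ a', y a' ⊗ₜ[K] β a' := by
    conv_lhs => rw [← (β.tensorProduct β).sum_repr X]
    rw [Fintype.sum_prod_type_right]
    refine Finset.sum_congr rfl fun a' _ => ?_
    simp only [y, TensorProduct.sum_tmul, ← TensorProduct.smul_tmul', Basis.tensorProduct_apply']
  -- the `y_{a'}` are right-orthogonal to everything, hence zero
  have hc : ∀ x a', B x (y a') = 0 := by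
    intro x a'
    have hx := h x
    rw [hX, map_sum] at hx
    simp only [lcontr_tmul] at hx
    exact Fintype.linearIndependent_iff.mp β.linearIndependent (fun a' => B x (y a')) hx a'
  have hy : ∀ a', y a' = 0 := fun a' => hBn.2 _ fun x => hc x a'
  rw [hX]
  exact Finset.sum_eq_zero fun a' _ => by rw [hy, TensorProduct.zero_tmul]

/-- **The Casimir is characterised by its contractions** (uniqueness). [folklore] -/
theorem eq_casimir_of_forall_lcontr (hBn : B.Nondegenerate) (β : Basis S K W) {X : W ⊗[K] W}
    (h : ∀ x, lcontr B x X = x) : X = casimir B β := by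
  rw [← sub_eq_zero]
  exact eq_zero_of_forall_lcontr B hBn β fun x => by rw [map_sub, h, lcontr_casimir B hBn β, sub_self]

/-- **The Casimir does not depend on the basis.** [folklore] -/
theorem casimir_eq_casimir (hBn : B.Nondegenerate) {S' : Type*} [Fintype S'] [DecidableEq S'] (β : Basis S K W)
    (β' : Basis S' K W) : casimir B β = casimir B β' :=
  eq_casimir_of_forall_lcontr B hBn β' (lcontr_casimir B hBn β)

/-! ### §2 Coordinate matrices of `2`-tensors -/

/-- The coordinate matrix of a `2`-tensor in the basis `β ⊗ β`. [folklore] -/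
def tmat (β : Basis S K W) (X : W ⊗[K] W) : Matrix S S K := fun a a' => (β.tensorProduct β).repr X (a, a')

omit [Fintype S] [DecidableEq S] in
/-- `tmat` is additive. [folklore] -/
theorem tmat_add (β : Basis S K W) (X Y : W ⊗[K] W) : tmat β (X + Y) = tmat β X + tmat β Y := by
  funext a a'; simp [tmat]

omit [Fintype S] [DecidableEq S] in
/-- `tmat` of a sum. [folklore] -/
theorem tmat_sum (β : Basis S K W) {ι : Type*} (s : Finset ι) (X : ι → W ⊗[K] W) :
    tmat β (∑ m ∈ s, X m) = ∑ m ∈ s, tmat β (X m) := by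
  funext a a'
  rw [Matrix.sum_apply]
  simp only [tmat, map_sum, Finsupp.coe_finsetSum, Finset.sum_apply]

omit [Fintype S] [DecidableEq S] in
/-- `tmat` of a scalar multiple. [folklore] -/
theorem tmat_smul (β : Basis S K W) (c : K) (X : W ⊗[K] W) : tmat β (c • X) = c • tmat β X := by
  funext a a'; simp [tmat]

omit [Fintype S] [DecidableEq S] in
/-- `tmat` of a pure tensor: `(y ⊗ y')_{α α'} = y_α y'_{α'}`. [folklore] -/
theorem tmat_tmul (β : Basis S K W) (y y' : W) (α α' : S) : tmat β (y ⊗ₜ[K] y') α α' = β.repr y α * β.repr y' α' := by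
  rw [tmat, Basis.tensorProduct_repr_tmul_apply, smul_eq_mul, mul_comm]

/-- `tmat β (casimir B β) = G_β⁻¹`. [folklore] -/
theorem tmat_casimir (β : Basis S K W) : tmat β (casimir B β) = (LinearMap.BilinForm.toMatrix β B)⁻¹ := by
  funext α α'
  unfold casimir
  rw [tmat_sum, Matrix.sum_apply]
  simp_rw [tmat_sum, Matrix.sum_apply, tmat_smul, Matrix.smul_apply, tmat_tmul, Basis.repr_self,
    Finsupp.single_apply, smul_eq_mul]
  rw [Finset.sum_eq_single α]
  · rw [Finset.sum_eq_single α']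
    · simp
    · intro a' _ ha'; rw [if_neg ha']; ring
    · intro hh; exact absurd (Finset.mem_univ _) hh
  · intro a _ ha; exact Finset.sum_eq_zero fun a' _ => by rw [if_neg ha]; ring
  · intro hh; exact absurd (Finset.mem_univ _) hh

/-- `tmat β ((A ⊗ id) X) = [A]_β · tmat β X`. [folklore] -/
theorem tmat_map_rTensor (β : Basis S K W) (A : W →ₗ[K] W) (X : W ⊗[K] W) :
    tmat β (TensorProduct.map A LinearMap.id X) = LinearMap.toMatrix β β A * tmat β X := by
  induction X using TensorProduct.induction_on with
  | zero =>
    funext a a'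
    simp [tmat, Matrix.mul_apply]
  | tmul y y' =>
    funext α α'
    rw [TensorProduct.map_tmul, LinearMap.id_apply, Matrix.mul_apply, tmat_tmul]
    simp_rw [tmat_tmul, ← mul_assoc, ← Finset.sum_mul]
    congr 1
    have h' := congrFun (LinearMap.toMatrix_mulVec_repr β β A y) α
    rw [← h']
    simp [Matrix.mulVec, dotProduct]
  | add X Y hX hY => rw [map_add, tmat_add, tmat_add, hX, hY, Matrix.mul_add]

end Casimir

/-! ### §3 The Casimir in the eigen-adapted basis and the eigen-Casimirs -/

section Adapted

variable [CharZero K] [FiniteDimensional K W] {σ : W →ₗ[K] W} {ζ : K} {p h : ℕ} {B : LinearMap.BilinForm K W}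
variable (hσ : σ ^ p = 1) (hζ : IsPrimitiveRoot ζ p) (hp : 0 < p) (hph : p = 2 * h + 1)
  (hB : ∀ x y, B (σ x) (σ y) = B x y) (hBn : B.Nondegenerate) (hBs : ∀ x y, B x y = B y x)
  {n : ℕ} (hn : ∀ j, 1 ≤ j → j < p → Module.finrank K ↥(E σ ζ p j) = n)
  {x₀ : W} (hx₀ : x₀ ≠ 0) (hx₀E : x₀ ∈ E σ ζ p 0) (hgen : ∀ x ∈ E σ ζ p 0, ∃ c : K, x = c • x₀)

/-- The candidate Casimir in the adapted basis. [folklore] -/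
def adaptedCasimir : W ⊗[K] W :=
  (B x₀ x₀)⁻¹ • x₀ ⊗ₜ[K] x₀ +
    ∑ i : Fin h, ∑ a : Fin n,
      (adaptedBasis hσ hζ hp hph hB hBn hn hx₀ hx₀E hgen (some (i, false, a)) ⊗ₜ[K]
          adaptedBasis hσ hζ hp hph hB hBn hn hx₀ hx₀E hgen (some (i, true, a)) +
        adaptedBasis hσ hζ hp hph hB hBn hn hx₀ hx₀E hgen (some (i, true, a)) ⊗ₜ[K]
          adaptedBasis hσ hζ hp hph hB hBn hn hx₀ hx₀E hgen (some (i, false, a)))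

include hBs in
/-- **The Casimir in the adapted basis**: `casimir B f = B(x₀,x₀)⁻¹ x₀ ⊗ x₀ + Σ_i Σ_a (e_{i,a} ⊗ e^{i,a} + e^{i,a} ⊗ e_{i,a})`.
[folklore] -/
theorem casimir_adaptedBasis :
    casimir B (adaptedBasis hσ hζ hp hph hB hBn hn hx₀ hx₀E hgen) =
      adaptedCasimir hσ hζ hp hph hB hBn hn hx₀ hx₀E hgen := by
  classical
  symm
  refine eq_casimir_of_forall_lcontr B hBn (adaptedBasis hσ hζ hp hph hB hBn hn hx₀ hx₀E hgen) fun x => ?_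
  -- reduce to basis vectors
  suffices hbasis : ∀ l, lcontr B (adaptedBasis hσ hζ hp hph hB hBn hn hx₀ hx₀E hgen l)
      (adaptedCasimir hσ hζ hp hph hB hBn hn hx₀ hx₀E hgen) = adaptedBasis hσ hζ hp hph hB hBn hn hx₀ hx₀E hgen l by
    have hlin : lcontrVec B (adaptedCasimir hσ hζ hp hph hB hBn hn hx₀ hx₀E hgen) = LinearMap.id :=
      (adaptedBasis hσ hζ hp hph hB hBn hn hx₀ hx₀E hgen).ext fun l => by rw [lcontrVec_apply, hbasis, LinearMap.id_apply]
    have := LinearMap.congr_fun hlin x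
    rwa [lcontrVec_apply, LinearMap.id_apply] at this
  have hq₀ := apply_x₀_x₀_ne_zero hσ hζ hp hB hBn hx₀ hx₀E hgen
  have hnd : ∀ k, 0 < k → k < p → ¬ p ∣ k := fun k hk0 hkp hd => absurd (Nat.le_of_dvd hk0 hd) (by omega)
  -- orthogonality facts between letters (blocks not complementary)
  have hzero : ∀ l l' : Option (Fin h × Bool × Fin n), ¬ p ∣ letterBlock p h n l + letterBlock p h n l' →
      B (adaptedBasis hσ hζ hp hph hB hBn hn hx₀ hx₀E hgen l) (adaptedBasis hσ hζ hp hph hB hBn hn hx₀ hx₀E hgen l') = 0 :=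
    fun l l' hll' => apply_adaptedBasis_eq_zero hσ hζ hp hph hB hBn hn hx₀ hx₀E hgen hll'
  have hx₀v : ∀ (i : Fin h) (b : Bool) (a : Fin n), B x₀ (adaptedBasis hσ hζ hp hph hB hBn hn hx₀ hx₀E hgen (some (i, b, a))) = 0 := by
    intro i b a
    have hi := i.2
    have h0 := hzero none (some (i, b, a)) (by
      cases b
      · simp only [letterBlock_none, letterBlock_vec]; exact hnd _ (by omega) (by omega)
      · simp only [letterBlock_none, letterBlock_cov]; exact hnd _ (by omega) (by omega))
    rwa [adaptedBasis_none] at h0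
  have hvx₀ : ∀ (i : Fin h) (b : Bool) (a : Fin n), B (adaptedBasis hσ hζ hp hph hB hBn hn hx₀ hx₀E hgen (some (i, b, a))) x₀ = 0 :=
    fun i b a => by rw [hBs, hx₀v]
  -- vec/vec and cov/cov pairings vanish; vec/cov of different colours vanish
  have hvv : ∀ (i i' : Fin h) (a a' : Fin n), B (adaptedBasis hσ hζ hp hph hB hBn hn hx₀ hx₀E hgen (some (i, false, a)))
      (adaptedBasis hσ hζ hp hph hB hBn hn hx₀ hx₀E hgen (some (i', false, a'))) = 0 := by
    intro i i' a a'
    have hi := i.2; have hi' := i'.2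
    exact hzero _ _ (by simp only [letterBlock_vec]; exact hnd _ (by omega) (by omega))
  have hcc : ∀ (i i' : Fin h) (a a' : Fin n), B (adaptedBasis hσ hζ hp hph hB hBn hn hx₀ hx₀E hgen (some (i, true, a)))
      (adaptedBasis hσ hζ hp hph hB hBn hn hx₀ hx₀E hgen (some (i', true, a'))) = 0 := by
    intro i i' a a'
    have hi := i.2; have hi' := i'.2
    refine hzero _ _ ?_
    simp only [letterBlock_cov]
    rw [show p - (i.val + 1) + (p - (i'.val + 1)) = p + (p - (i.val + i'.val + 2)) by omega]
    intro hd
    have := Nat.le_of_dvd (by omega) ((Nat.dvd_add_right (dvd_refl p)).mp hd)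
    omega
  have hvc : ∀ (i i' : Fin h), i ≠ i' → ∀ (a a' : Fin n), B (adaptedBasis hσ hζ hp hph hB hBn hn hx₀ hx₀E hgen (some (i, false, a)))
      (adaptedBasis hσ hζ hp hph hB hBn hn hx₀ hx₀E hgen (some (i', true, a'))) = 0 := by
    intro i i' hii a a'
    have hi := i.2; have hi' := i'.2
    have hii' : i.val ≠ i'.val := fun e => hii (Fin.ext e)
    refine hzero _ _ ?_
    simp only [letterBlock_vec, letterBlock_cov]
    rw [show i.val + 1 + (p - (i'.val + 1)) = p + i.val - i'.val by omega]
    intro hd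
    rcases le_or_gt i'.val i.val with hle | hlt
    · have := Nat.le_of_dvd (by omega) (Nat.dvd_sub hd (dvd_refl p)); omega
    · have h2 : p ∣ p - (p + i.val - i'.val) := Nat.dvd_sub (dvd_refl p) hd
      have := Nat.le_of_dvd (by omega) h2; omega
  have hcv : ∀ (i i' : Fin h), i ≠ i' → ∀ (a a' : Fin n), B (adaptedBasis hσ hζ hp hph hB hBn hn hx₀ hx₀E hgen (some (i, true, a)))
      (adaptedBasis hσ hζ hp hph hB hBn hn hx₀ hx₀E hgen (some (i', false, a'))) = 0 :=
    fun i i' hii a a' => by rw [hBs, hvc i' i (Ne.symm hii)]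
  intro l
  unfold adaptedCasimir
  simp only [map_add, map_sum, map_smul, lcontr_tmul, smul_smul]
  rcases l with _ | ⟨i₁, b₁, a₁⟩
  · -- `x₀`: only the first term survives
    rw [adaptedBasis_none, inv_mul_cancel₀ hq₀, one_smul, Finset.sum_eq_zero, add_zero]
    intro i _
    refine Finset.sum_eq_zero fun a _ => ?_
    rw [hx₀v, hx₀v, zero_smul, zero_smul, add_zero]
  · cases b₁
    · -- vector letter `e_{i₁, a₁}`: picked out of the second family of summands
      rw [hvx₀, mul_zero, zero_smul, zero_add, Finset.sum_eq_single i₁]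
      · rw [Finset.sum_eq_single a₁]
        · rw [hvv, zero_smul, zero_add, apply_adaptedBasis_vec_cov, if_pos rfl, one_smul]
        · intro a _ ha
          rw [hvv, zero_smul, zero_add, apply_adaptedBasis_vec_cov, if_neg (Ne.symm ha), zero_smul]
        · intro hh; exact absurd (Finset.mem_univ _) hh
      · intro i _ hi
        exact Finset.sum_eq_zero fun a _ => by rw [hvv, hvc i₁ i (Ne.symm hi), zero_smul, zero_smul, add_zero]
      · intro hh; exact absurd (Finset.mem_univ _) hh
    · -- covector letter `e^{i₁, a₁}`
      rw [hvx₀, mul_zero, zero_smul, zero_add, Finset.sum_eq_single i₁]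
      · rw [Finset.sum_eq_single a₁]
        · rw [hcc, zero_smul, add_zero, apply_adaptedBasis_cov_vec hσ hζ hp hph hB hBn hn hx₀ hx₀E hgen hBs, if_pos rfl, one_smul]
        · intro a _ ha
          rw [hcc, zero_smul, add_zero, apply_adaptedBasis_cov_vec hσ hζ hp hph hB hBn hn hx₀ hx₀E hgen hBs, if_neg ha, zero_smul]
        · intro hh; exact absurd (Finset.mem_univ _) hh
      · intro i _ hi
        exact Finset.sum_eq_zero fun a _ => by rw [hcv i₁ i (Ne.symm hi), hcc, zero_smul, zero_smul, add_zero]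
      · intro hh; exact absurd (Finset.mem_univ _) hh

/-- **The eigen-Casimir**: `(P_{i+1} ⊗ id) (casimir B f) = Σ_a e_{i,a} ⊗ e^{i,a}`. [folklore] -/
theorem map_specProj_casimir (hBs : ∀ x y, B x y = B y x) (i : Fin h) :
    TensorProduct.map (specProj σ ζ p (i.val + 1)) LinearMap.id (casimir B (adaptedBasis hσ hζ hp hph hB hBn hn hx₀ hx₀E hgen)) =
      ∑ a : Fin n, adaptedBasis hσ hζ hp hph hB hBn hn hx₀ hx₀E hgen (some (i, false, a)) ⊗ₜ[K]
        adaptedBasis hσ hζ hp hph hB hBn hn hx₀ hx₀E hgen (some (i, true, a)) := by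
  have hi := i.2
  rw [casimir_adaptedBasis hσ hζ hp hph hB hBn hBs hn hx₀ hx₀E hgen]
  unfold adaptedCasimir
  have hP : ∀ l, specProj σ ζ p (i.val + 1) (adaptedBasis hσ hζ hp hph hB hBn hn hx₀ hx₀E hgen l) =
      if letterBlock p h n l = i.val + 1 then adaptedBasis hσ hζ hp hph hB hBn hn hx₀ hx₀E hgen l else 0 :=
    fun l => specProj_adaptedBasis hσ hζ hp hph hB hBn hn hx₀ hx₀E hgen _ (by omega) l
  have hPx₀ : specProj σ ζ p (i.val + 1) x₀ = 0 := by
    have h0 := hP none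
    rwa [adaptedBasis_none, letterBlock_none, if_neg (by omega)] at h0
  simp only [map_add, map_smul, map_sum, TensorProduct.map_tmul, LinearMap.id_apply]
  rw [hPx₀, TensorProduct.zero_tmul, smul_zero, zero_add]
  rw [Finset.sum_eq_single i]
  · refine Finset.sum_congr rfl fun a _ => ?_
    rw [hP, hP, letterBlock_vec, letterBlock_cov, if_pos rfl, if_neg (by omega), TensorProduct.zero_tmul, add_zero]
  · intro i' _ hi'
    have hii : i'.val ≠ i.val := fun e => hi' (Fin.ext e)
    have hi'2 := i'.2
    refine Finset.sum_eq_zero fun a _ => ?_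
    rw [hP, hP, letterBlock_vec, letterBlock_cov, if_neg (by omega), if_neg (by omega), TensorProduct.zero_tmul,
      TensorProduct.zero_tmul, add_zero]
  · intro hh; exact absurd (Finset.mem_univ _) hh

/-- **The eigen-Casimir identity in any basis `β` of `W`**:
`Σ_a β.repr (e_{i,a}) α · β.repr (e^{i,a}) α' = ([P_{i+1}]_β · G_β⁻¹) α α'`. [folklore] -/
theorem sum_repr_vec_mul_repr_cov (hBs : ∀ x y, B x y = B y x) {S : Type*} [Fintype S] [DecidableEq S]
    (β : Basis S K W) (i : Fin h) (α α' : S) :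
    ∑ a : Fin n, β.repr (adaptedBasis hσ hζ hp hph hB hBn hn hx₀ hx₀E hgen (some (i, false, a))) α *
        β.repr (adaptedBasis hσ hζ hp hph hB hBn hn hx₀ hx₀E hgen (some (i, true, a))) α' =
      (LinearMap.toMatrix β β (specProj σ ζ p (i.val + 1)) * (LinearMap.BilinForm.toMatrix β B)⁻¹) α α' := by
  have h := congrArg (fun X => tmat β X α α') (map_specProj_casimir hσ hζ hp hph hB hBn hn hx₀ hx₀E hgen hBs i)
  rw [casimir_eq_casimir B hBn (adaptedBasis hσ hζ hp hph hB hBn hn hx₀ hx₀E hgen) β, tmat_map_rTensor, tmat_casimir,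
    tmat_sum, Matrix.sum_apply] at h
  simp only [tmat_tmul] at h
  exact h.symm

end Adapted

end Summit.HodgeConjecture.HodgeConjecture.Theorems.CyclicUnitaryPowersCasimirMatrix

end
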